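import Summits.CriticalPhenomena.Ising3DConformalLimit.Theorems.HyperoctahedralRPExistsScaleCovariantLimitFoldedCurrentUniqueness
import HarnessLib

/-!
# Crux `ExistsScaleCovariantLimit` (item stmt-CriticalPhenomena-1981): the SPLIT GLUE, in a route-file-independent module

Crux-strategist `planner-cstrat-stmt-CriticalPhenomena-1981-s1-0` (2026-08-17), routes `PositivityBegetsConformality`,
`HarmonicMomentsIsotropy` (and every other route sharing the decl). The shared existence crux

  `ExistsScaleCovariantLimit` — existence of the full pointwise scaling limit of the critical `ℤ³` Ising correlators,
  normalised, non-degenerate, translation invariant and scale covariant (H. Duminil-Copin, ICM 2022, §8.4: "widely open") —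

is, kernel-checked, the conjunction of two EXISTING ledger items with their own crux chains
(`FoldedCurrentRepulsion.crux_iff_doubling_and_totallyDisconnected`, p139907):

* item stmt-CriticalPhenomena-6150 `MirrorHoelderCompactness.TwoPointDoubling` — all-scale doubling of the axial critical
  two-point function (the COMPACTNESS half; ⟺ `OrbitPrecompact` 5955 ⟺ `UniformRegularity` 4658, p120504; the open
  log-free axial gradient bound of Aizenman–Duminil-Copin 2021, Remark 5.10, p132478);
* item stmt-CriticalPhenomena-4659 `ClusterRigidity.ClusterSetTotallyDisconnected` — total disconnectedness of the cluster
  set of the self-normalised correlators (the IDENTIFICATION half; under compactness ⟺ uniqueness of the pinned cluster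
  point, p139907).

This module states the two directions of that equivalence in the ARROW form a route split consumes
(`ExistsScaleCovariantLimit_of_subs : Sub₁ → Sub₂ → crux`, `subs_of_ExistsScaleCovariantLimit : crux → Sub₁ ∧ Sub₂`) and,
for robustness, with every constant unfolded to the ledger signatures (`…_raw`). DESIGN: it deliberately imports NO
`Theses` file of the routes being split (`PositivityBegetsConformality`, `HarmonicMomentsIsotropy`, `GaussianScaleMixture`, …)
— only `Theses.HyperoctahedralRP` / `MirrorHoelderCompactness` / `ClusterRigidity` arrive transitively — so the gate may cite
`ExistsScaleCovariantLimit_of_subs` as `--glue-by` INSIDE those route files (all route copies of the decl have one body; the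
HRP-typed term is accepted at each copy by `δ`-unfolding, as `Lines/folded_current_repulsion.lean` v7 `_proof_pbc` shows).
Nothing is weakened or strengthened; no definitions; composition of landed theorems only.

Why neither child is the crux reworded (census `Cruxes/ExistsScaleCovariantLimit/STRATEGY-CENSUS.md` §Decomposition):
`TwoPointDoubling` is a two-point statement satisfied by the discretely-self-similar family `W_ε` of
`ExistsScaleCovariantLimitNegative` (Disproof §E), which has no scaling limit; `ClusterSetTotallyDisconnected` quantifies over
locally uniform cluster points only and is silent along scales where the pinned zoom diverges, so it does not give
`TwoPointDoubling`.

References: H. Duminil-Copin, *100 years of the (critical) Ising model on the hypercubic lattice*, ICM 2022, §8.4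
[DuminilCopinICM2022]; M. Aizenman, H. Duminil-Copin, Ann. of Math. 194 (2021), Remark 5.10 [AizenmanDuminilCopinAnnals2021];
S. Rychkov, C. R. Physique 21 (2020) 185, p. 8 [Rychkov2020].
-/

namespace Summit.CriticalPhenomena.Ising3DConformalLimit.Cruxes.ExistsScaleCovariantLimit.Split

open Summit.CriticalPhenomena.Ising3DConformalLimit.Theses
open Summit.CriticalPhenomena.Ising3DConformalLimit.Cruxes.ExistsScaleCovariantLimit.FoldedCurrentRepulsion
  (crux_iff_doubling_and_totallyDisconnected)

/-- **SPLIT GLUE.** Item 6150 `TwoPointDoubling` and item 4659 `ClusterSetTotallyDisconnected` together give the crux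
`ExistsScaleCovariantLimit` (stated on route `HyperoctahedralRP`'s copy of the shared decl; every other route copy has the
same body). [folklore] -/
theorem ExistsScaleCovariantLimit_of_subs :
    MirrorHoelderCompactness.TwoPointDoubling → ClusterRigidity.ClusterSetTotallyDisconnected →
      HyperoctahedralRP.ExistsScaleCovariantLimit :=
  fun hD hT => crux_iff_doubling_and_totallyDisconnected.2 ⟨hD, hT⟩

/-- **EXACTNESS of the split.** The crux gives back both children: it forces all-scale doubling (item 6150) and total
disconnectedness of the cluster set (item 4659). [folklore] -/
theorem subs_of_ExistsScaleCovariantLimit :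
    HyperoctahedralRP.ExistsScaleCovariantLimit →
      MirrorHoelderCompactness.TwoPointDoubling ∧ ClusterRigidity.ClusterSetTotallyDisconnected :=
  crux_iff_doubling_and_totallyDisconnected.1

/-- The split glue with every constant unfolded to the ledger signatures of items 6150, 4659 and 1981 (verbatim), so that
it can be matched against freshly rendered route-file children without relying on which route's named copy is in scope.
[folklore] -/
theorem ExistsScaleCovariantLimit_of_subs_raw :
    (∃ κ : ℝ, 0 < κ ∧ ∀ n : ℕ, 1 ≤ n → κ * Literature.Probability.LatticeModels.criticalTwoPoint 3 (Pi.single 0 (n : ℤ)) ≤ Literature.Probability.LatticeModels.criticalTwoPoint 3 (Pi.single 0 (2 * (n : ℤ)))) →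
    (IsTotallyDisconnected {S : Literature.Probability.LatticeModels.CorrFamily 3 | (∀ n x, x ∉ Literature.Probability.LatticeModels.NonCoincident 3 n → S n x = 0) ∧ ∃ u : ℕ → ℝ, (∀ k, u k ∈ Set.Ioc (0:ℝ) 1) ∧ Filter.Tendsto u Filter.atTop (nhds 0) ∧ ∀ n, TendstoLocallyUniformlyOn (fun k => Literature.Probability.LatticeModels.rescaledCorrelator (Literature.Probability.LatticeModels.criticalCorr 3) (fun δ : ℝ => (Literature.Probability.LatticeModels.criticalTwoPoint 3 (Pi.single 0 ⌊δ⁻¹⌋)) ^ (-(1/2:ℝ))) n (u k)) (S n) Filter.atTop (Literature.Probability.LatticeModels.NonCoincident 3 n)}) →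
    (∃ (ρ : ℝ → ℝ) (Δ : ℝ) (S : Literature.Probability.LatticeModels.CorrFamily 3), (∀ δ ∈ Set.Ioc (0:ℝ) 1, 0 < ρ δ) ∧ 0 < Δ ∧ Literature.Probability.LatticeModels.HasPointwiseScalingLimit (Literature.Probability.LatticeModels.criticalCorr 3) ρ S ∧ (∀ n z, z ∉ Literature.Probability.LatticeModels.NonCoincident 3 n → S n z = 0) ∧ Literature.Probability.LatticeModels.IsNondegenerateTwoPoint S ∧ Literature.Probability.LatticeModels.IsTranslationInvariant S ∧ Literature.Probability.LatticeModels.IsScaleCovariant Δ S) :=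
  ExistsScaleCovariantLimit_of_subs

/-- Exactness, raw form. [folklore] -/
theorem subs_of_ExistsScaleCovariantLimit_raw :
    (∃ (ρ : ℝ → ℝ) (Δ : ℝ) (S : Literature.Probability.LatticeModels.CorrFamily 3), (∀ δ ∈ Set.Ioc (0:ℝ) 1, 0 < ρ δ) ∧ 0 < Δ ∧ Literature.Probability.LatticeModels.HasPointwiseScalingLimit (Literature.Probability.LatticeModels.criticalCorr 3) ρ S ∧ (∀ n z, z ∉ Literature.Probability.LatticeModels.NonCoincident 3 n → S n z = 0) ∧ Literature.Probability.LatticeModels.IsNondegenerateTwoPoint S ∧ Literature.Probability.LatticeModels.IsTranslationInvariant S ∧ Literature.Probability.LatticeModels.IsScaleCovariant Δ S) →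
    (∃ κ : ℝ, 0 < κ ∧ ∀ n : ℕ, 1 ≤ n → κ * Literature.Probability.LatticeModels.criticalTwoPoint 3 (Pi.single 0 (n : ℤ)) ≤ Literature.Probability.LatticeModels.criticalTwoPoint 3 (Pi.single 0 (2 * (n : ℤ)))) ∧
    (IsTotallyDisconnected {S : Literature.Probability.LatticeModels.CorrFamily 3 | (∀ n x, x ∉ Literature.Probability.LatticeModels.NonCoincident 3 n → S n x = 0) ∧ ∃ u : ℕ → ℝ, (∀ k, u k ∈ Set.Ioc (0:ℝ) 1) ∧ Filter.Tendsto u Filter.atTop (nhds 0) ∧ ∀ n, TendstoLocallyUniformlyOn (fun k => Literature.Probability.LatticeModels.rescaledCorrelator (Literature.Probability.LatticeModels.criticalCorr 3) (fun δ : ℝ => (Literature.Probability.LatticeModels.criticalTwoPoint 3 (Pi.single 0 ⌊δ⁻¹⌋)) ^ (-(1/2:ℝ))) n (u k)) (S n) Filter.atTop (Literature.Probability.LatticeModels.NonCoincident 3 n)}) :=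
  subs_of_ExistsScaleCovariantLimit

end Summit.CriticalPhenomena.Ising3DConformalLimit.Cruxes.ExistsScaleCovariantLimit.Split
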